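import Summits.ValiantsHypothesis.ValiantsHypothesis.Theorems.LacunarySymmetroidMatrixDescartesCensusDoorA34HollowCornerLinePair
import Summits.ValiantsHypothesis.ValiantsHypothesis.Theorems.LacunarySymmetroidMatrixDescartesCensusDoorA34RootRank
import Summits.ValiantsHypothesis.ValiantsHypothesis.Theorems.LacunarySymmetroidMatrixDescartesCensusDoorA34EqualDiagonalChartRows

/-!
# `MatrixDescartes` census — DOOR A at `(3,4)`: the HOLLOW-CORNER CHART ON THE R2 SECTOR — a UNIQUE SIMPLE real root of the
# annihilator cubic forces a real line-pair frame (chart completeness for the third generic node class)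

HONEST FRAMING.  Object-search cell `pub-symmetroid`, door-A seat `val-sym-door-p3` (g17); item stmt-ValiantsHypothesis-19980
`DoorA34 = PosRootLawAt 3 4 18` (route item `Theses.LacunarySymmetroid.DoorA34`) is OPEN and asserted nowhere in this file.
Nothing here bounds `ζ_sym(3,4)`; nothing bears on `MatrixDescartes` (stmt-ValiantsHypothesis-18050) or on `VP ≠ VNP`.

CONTENT (all supports; no `def`, no `sorry`).  `…CensusDoorA34EqualDiagonalChartRows` charts the nets whose annihilator pencil
`(B₁, B₂)` is REALLY SPLIT (three distinct real generalised eigenvalues: classes R4 / R0); `…CensusDoorA34HollowCornerChart` charts every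
net whose annihilator carries a real line pair with non-isotropic vertex, the line pair being a DATUM.  This file PRODUCES that datum on the
complementary generic sector R2: `det B₁ ≠ 0` and the cubic `x ↦ det (B₂ − xB₁)` has a UNIQUE real root `μ`, which is SIMPLE
(`tr(adj(B₂ − μB₁)·B₁) ≠ 0`).
* §8 lemmas: `cubic_coeff_unique`; **`discr_detPencil_nonneg`** (a DEFINITE-ANCHORED binary pencil is real-rooted:
  `g₁₁²·(τ² − 4·det G·det H) = (g₁₁τ − 2·det G·h₁₁)² + 4·det G·(g₁₁h₁₂ − g₁₂h₁₁)²`), `exists_ne_zero_detPencil_eq_zero`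
  (`det G > 0`, `det H ≠ 0` ⇒ a NON-ZERO real singular parameter), `exists_isotropic_pair` (an indefinite binary form has an independent
  isotropic pair with non-zero pairing), `exists_perp_pair` (a frame of `N^⊥` with `det[v,p₁,p₂] = c·(v·N)`), `dotProduct_mulVec_combo`,
  `det_of_combo_rows`;
* §9 **`exists_congr_hollowCorner_of_uniqueRoot`** — THE R2 CHART: under the hypotheses above ONE congruence brings every letter to
  hollow-corner form `S_l = Pᵀ [[ε₁u_l + ε₂w_l, α_l, β_l], [α_l, u_l, 0], [β_l, 0, w_l]] P`, `εᵢ ∈ {1,0,−1}` fixed.  Proof: `K = B₂ − μB₁`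
  has a kernel vector `v` among the columns of `adj K` with `a = vᵀB₁v ≠ 0` (`tr adj K · tr(adj K·B₁) = ∑ᵢ colᵢᵀB₁colᵢ`, and
  `adj K ≠ 0` by simplicity); in a frame `(v, p₁, p₂)`, `pᵢ ⊥ B₁v`, the pencil is `(−ya) ⊕ (G − yH)` and comparing cubic coefficients
  gives `det G ≠ 0 ≠ det H`; `det G > 0` would give a second real root (`exists_ne_zero_detPencil_eq_zero`), so `det G < 0`: `K` is a
  real line pair on the frame plane, and its isotropic pair is the frame of `exists_congr_hollowCorner_of_frame`;
  census form **`card_posRoots_eq_hollowCorner_of_uniqueRoot`**, **`card_posRoots_le_of_hollowCorner_rows_uniqueRoot`**.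
With `…EqualDiagonalChartRows` the chart atlas now covers every net with `det B₁ ≠ 0` whose annihilator cubic has either three distinct
real roots or a unique simple one — i.e. every net off the discriminant hypersurface (`…CensusOffHypersurface` reduces `DoorA34` to rows off
ANY hypersurface; the remaining kernel step is the explicit annihilator basis + the discriminant dichotomy, pure algebra).
[folklore] Pencils of conics / pairs of real quadratic forms; elementary.
-/

-- `Summit.ValiantsHypothesis.ValiantsHypothesis.…` repeats a component by the D-0017 layout
-- (single-conjunct summit), which the `dupNamespace` linter flags; the name is mandated.
set_option linter.dupNamespace false

namespace Summit.ValiantsHypothesis.ValiantsHypothesis.Theorems.LacunarySymmetroidMatrixDescartes.Census.EqualDiagonal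

open Matrix Finset
open scoped BigOperators

/-! ## 8. Lemmas: cubic coefficients, definite-anchored binary pencils, isotropic pairs, perpendicular frames -/

/-- Two cubics through the origin that agree as functions have the same coefficients. [folklore] -/
theorem cubic_coeff_unique (c₁ c₂ c₃ d₁ d₂ d₃ : ℝ)
    (h : ∀ y : ℝ, c₁ * y + c₂ * y ^ 2 + c₃ * y ^ 3 = d₁ * y + d₂ * y ^ 2 + d₃ * y ^ 3) :
    c₁ = d₁ ∧ c₂ = d₂ ∧ c₃ = d₃ := by
  have h1 := h 1
  have h2 := h (-1)
  have h3 := h 2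
  norm_num at h1 h2 h3
  refine ⟨by linarith, by linarith, by linarith⟩

/-- **A definite-anchored binary pencil is real-rooted**: if `det G > 0` (`G` a real symmetric `2 × 2` matrix, hence definite) then the
quadratic `y ↦ det (G − yH)` has non-negative discriminant, by the sum-of-squares identity
`g₁₁²·(τ² − 4·det G·det H) = (g₁₁τ − 2·det G·h₁₁)² + 4·det G·(g₁₁h₁₂ − g₁₂h₁₁)²`, `τ = tr(adj G·H)`. [folklore] -/
theorem discr_detPencil_nonneg (g₁₁ g₁₂ g₂₂ h₁₁ h₁₂ h₂₂ : ℝ) (hg : 0 < g₁₁ * g₂₂ - g₁₂ ^ 2) :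
    0 ≤ (g₂₂ * h₁₁ - 2 * g₁₂ * h₁₂ + g₁₁ * h₂₂) ^ 2 - 4 * (g₁₁ * g₂₂ - g₁₂ ^ 2) * (h₁₁ * h₂₂ - h₁₂ ^ 2) := by
  have hg11 : g₁₁ ≠ 0 := by
    intro h0; rw [h0] at hg; nlinarith [sq_nonneg g₁₂]
  have key : g₁₁ ^ 2 * ((g₂₂ * h₁₁ - 2 * g₁₂ * h₁₂ + g₁₁ * h₂₂) ^ 2 - 4 * (g₁₁ * g₂₂ - g₁₂ ^ 2) * (h₁₁ * h₂₂ - h₁₂ ^ 2))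
      = (g₁₁ * (g₂₂ * h₁₁ - 2 * g₁₂ * h₁₂ + g₁₁ * h₂₂) - 2 * (g₁₁ * g₂₂ - g₁₂ ^ 2) * h₁₁) ^ 2
        + 4 * (g₁₁ * g₂₂ - g₁₂ ^ 2) * (g₁₁ * h₁₂ - g₁₂ * h₁₁) ^ 2 := by ring
  have hpos : 0 < g₁₁ ^ 2 := by positivity
  have hrhs : 0 ≤ (g₁₁ * (g₂₂ * h₁₁ - 2 * g₁₂ * h₁₂ + g₁₁ * h₂₂) - 2 * (g₁₁ * g₂₂ - g₁₂ ^ 2) * h₁₁) ^ 2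
        + 4 * (g₁₁ * g₂₂ - g₁₂ ^ 2) * (g₁₁ * h₁₂ - g₁₂ * h₁₁) ^ 2 := by positivity
  rw [← key] at hrhs
  exact (mul_nonneg_iff_of_pos_left hpos).mp hrhs

/-- **A definite-anchored binary pencil with invertible `H` has a NON-ZERO real singular parameter**: `det G > 0`, `det H ≠ 0` ⇒
`∃ y ≠ 0, det (G − yH) = 0`. [folklore] -/
theorem exists_ne_zero_detPencil_eq_zero (g₁₁ g₁₂ g₂₂ h₁₁ h₁₂ h₂₂ : ℝ) (hg : 0 < g₁₁ * g₂₂ - g₁₂ ^ 2)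
    (hh : h₁₁ * h₂₂ - h₁₂ ^ 2 ≠ 0) :
    ∃ y : ℝ, y ≠ 0 ∧ (g₁₁ - y * h₁₁) * (g₂₂ - y * h₂₂) - (g₁₂ - y * h₁₂) ^ 2 = 0 := by
  set a := h₁₁ * h₂₂ - h₁₂ ^ 2 with ha
  set τ := g₂₂ * h₁₁ - 2 * g₁₂ * h₁₂ + g₁₁ * h₂₂ with hτ
  set c := g₁₁ * g₂₂ - g₁₂ ^ 2 with hc
  have hD := discr_detPencil_nonneg g₁₁ g₁₂ g₂₂ h₁₁ h₁₂ h₂₂ hg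
  set D := τ ^ 2 - 4 * c * a with hDdef
  have hD' : 0 ≤ D := by rw [hDdef, hτ, hc, ha]; convert hD using 2
  set s := Real.sqrt D with hs
  have hss : s * s = D := Real.mul_self_sqrt hD'
  have hs0 : 0 ≤ s := Real.sqrt_nonneg _
  have hdisc : discrim a (-τ) c = s * s := by rw [discrim, hss, hDdef]; ring
  have hquad : ∀ y, (g₁₁ - y * h₁₁) * (g₂₂ - y * h₂₂) - (g₁₂ - y * h₁₂) ^ 2 = a * (y * y) + (-τ) * y + c := by
    intro y; rw [ha, hτ, hc]; ring
  -- choose the root whose numerator cannot vanish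
  rcases le_or_gt 0 τ with hτ0 | hτ0
  · refine ⟨(-(-τ) + s) / (2 * a), ?_, ?_⟩
    · have hnum : -(-τ) + s ≠ 0 := by
        intro h0
        have hτs : τ = 0 ∧ s = 0 := by constructor <;> linarith
        have : D = 0 := by rw [← hss, hτs.2, mul_zero]
        rw [hDdef, hτs.1] at this
        have : c * a = 0 := by linarith
        rcases mul_eq_zero.mp this with h1 | h1
        · exact absurd h1 hg.ne'
        · exact hh h1
      exact div_ne_zero hnum (mul_ne_zero two_ne_zero hh)
    · rw [hquad]; exact (quadratic_eq_zero_iff hh hdisc _).mpr (Or.inl rfl)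
  · refine ⟨(-(-τ) - s) / (2 * a), ?_, ?_⟩
    · have hnum : -(-τ) - s ≠ 0 := by intro h0; linarith
      exact div_ne_zero hnum (mul_ne_zero two_ne_zero hh)
    · rw [hquad]; exact (quadratic_eq_zero_iff hh hdisc _).mpr (Or.inr rfl)

/-- **Isotropic pair of an indefinite binary form**: if `g₁₁g₂₂ − g₁₂² < 0` there are two isotropic vectors `(s₁,t₁)`, `(s₂,t₂)` of
`g₁₁s² + 2g₁₂st + g₂₂t²`, independent, with non-zero polar pairing. [folklore] -/
theorem exists_isotropic_pair (g₁₁ g₁₂ g₂₂ : ℝ) (hg : g₁₁ * g₂₂ - g₁₂ ^ 2 < 0) :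
    ∃ s₁ t₁ s₂ t₂ : ℝ,
      g₁₁ * s₁ ^ 2 + 2 * g₁₂ * s₁ * t₁ + g₂₂ * t₁ ^ 2 = 0 ∧
      g₁₁ * s₂ ^ 2 + 2 * g₁₂ * s₂ * t₂ + g₂₂ * t₂ ^ 2 = 0 ∧
      g₁₁ * s₁ * s₂ + g₁₂ * (s₁ * t₂ + s₂ * t₁) + g₂₂ * t₁ * t₂ ≠ 0 ∧ s₁ * t₂ - s₂ * t₁ ≠ 0 := by
  rcases eq_or_ne g₁₁ 0 with h0 | h0
  · -- `g₁₁ = 0`: the pair `(1,0)`, `(−g₂₂, 2g₁₂)`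
    have h12 : g₁₂ ≠ 0 := by intro h; rw [h0, h] at hg; norm_num at hg
    refine ⟨1, 0, -g₂₂, 2 * g₁₂, ?_, ?_, ?_, ?_⟩
    · rw [h0]; ring
    · rw [h0]; ring
    · rw [h0]; ring_nf; positivity
    · ring_nf; exact mul_ne_zero h12 two_ne_zero
  · -- `g₁₁ ≠ 0`: the two roots of `g₁₁r² + 2g₁₂r + g₂₂`
    set D := g₁₂ ^ 2 - g₁₁ * g₂₂ with hD
    have hDpos : 0 < D := by rw [hD]; linarith
    set s := Real.sqrt D with hs
    have hss : s * s = D := Real.mul_self_sqrt hDpos.le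
    have hspos : 0 < s := Real.sqrt_pos.mpr hDpos
    refine ⟨(-g₁₂ + s) / g₁₁, 1, (-g₁₂ - s) / g₁₁, 1, ?_, ?_, ?_, ?_⟩
    · field_simp
      nlinarith [hss]
    · field_simp
      nlinarith [hss]
    · have : g₁₁ * ((-g₁₂ + s) / g₁₁) * ((-g₁₂ - s) / g₁₁) + g₁₂ * ((-g₁₂ + s) / g₁₁ * 1 + (-g₁₂ - s) / g₁₁ * 1)
          + g₂₂ * 1 * 1 = -2 * D / g₁₁ := by
        field_simp
        nlinarith [hss]
      rw [this]
      exact div_ne_zero (mul_ne_zero (by norm_num) hDpos.ne') h0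
    · have : (-g₁₂ + s) / g₁₁ * 1 - (-g₁₂ - s) / g₁₁ * 1 = 2 * s / g₁₁ := by field_simp; ring
      rw [this]
      exact div_ne_zero (mul_ne_zero two_ne_zero hspos.ne') h0

/-- **Perpendicular frame**: for `N ≠ 0` in `ℝ³` there are `p₁, p₂ ⊥ N` with `det[v, p₁, p₂] = c·(v·N)`, `c ≠ 0`, for every `v`
(`pᵢ = N × eⱼ` for the two coordinate vectors other than a non-zero coordinate of `N`). [folklore] -/
theorem exists_perp_pair (N : Fin 3 → ℝ) (hN : N ≠ 0) :
    ∃ (p₁ p₂ : Fin 3 → ℝ) (c : ℝ), c ≠ 0 ∧ N ⬝ᵥ p₁ = 0 ∧ N ⬝ᵥ p₂ = 0 ∧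
      ∀ v : Fin 3 → ℝ, (Matrix.of ![v, p₁, p₂]).det = c * (v ⬝ᵥ N) := by
  have hex : ∃ k, N k ≠ 0 := by
    by_contra h
    push Not at h
    exact hN (funext h)
  obtain ⟨k, hk⟩ := hex
  fin_cases k
  · refine ⟨![-N 2, 0, N 0], ![N 1, -N 0, 0], N 0, hk, ?_, ?_, fun v => ?_⟩
    · simp [dotProduct, Fin.sum_univ_three]; ring
    · simp [dotProduct, Fin.sum_univ_three]; ring
    · simp [Matrix.det_fin_three, dotProduct, Fin.sum_univ_three]; ring
  · refine ⟨![N 1, -N 0, 0], ![0, N 2, -N 1], N 1, hk, ?_, ?_, fun v => ?_⟩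
    · simp [dotProduct, Fin.sum_univ_three]; ring
    · simp [dotProduct, Fin.sum_univ_three]; ring
    · simp [Matrix.det_fin_three, dotProduct, Fin.sum_univ_three]; ring
  · refine ⟨![0, N 2, -N 1], ![-N 2, 0, N 0], N 2, hk, ?_, ?_, fun v => ?_⟩
    · simp [dotProduct, Fin.sum_univ_three]; ring
    · simp [dotProduct, Fin.sum_univ_three]; ring
    · simp [Matrix.det_fin_three, dotProduct, Fin.sum_univ_three]; ring

/-- Bilinear bookkeeping: the form of `K` on combinations of two vectors. [folklore] -/
theorem dotProduct_mulVec_combo {K : Matrix (Fin 3) (Fin 3) ℝ} (hK : K.IsSymm) (p₁ p₂ : Fin 3 → ℝ) (s t s' t' : ℝ) :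
    (s • p₁ + t • p₂) ⬝ᵥ (K *ᵥ (s' • p₁ + t' • p₂))
      = s * s' * (p₁ ⬝ᵥ (K *ᵥ p₁)) + (s * t' + s' * t) * (p₁ ⬝ᵥ (K *ᵥ p₂)) + t * t' * (p₂ ⬝ᵥ (K *ᵥ p₂)) := by
  have hsy : p₂ ⬝ᵥ (K *ᵥ p₁) = p₁ ⬝ᵥ (K *ᵥ p₂) := by
    rw [Matrix.dotProduct_mulVec, ← Matrix.mulVec_transpose, hK.eq, dotProduct_comm]
  simp only [Matrix.mulVec_add, Matrix.mulVec_smul, dotProduct_add, dotProduct_smul, add_dotProduct, smul_dotProduct,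
    smul_eq_mul, hsy]
  ring

/-- Determinant bookkeeping: replacing the last two rows by combinations multiplies `det` by the `2 × 2` coefficient determinant. [folklore] -/
theorem det_of_combo_rows (v p₁ p₂ : Fin 3 → ℝ) (s₁ t₁ s₂ t₂ : ℝ) :
    (Matrix.of ![v, s₁ • p₁ + t₁ • p₂, s₂ • p₁ + t₂ • p₂]).det = (s₁ * t₂ - s₂ * t₁) * (Matrix.of ![v, p₁, p₂]).det := by
  simp [Matrix.det_fin_three]
  ring

/-! ## 9. The R2 chart theorem: a unique, simple real root of the annihilator cubic -/

/-- **THE HOLLOW-CORNER CHART ON THE R2 SECTOR (all supports).**  Let the real symmetric letters `S₀,…,S₃` be annihilated (trace pairing)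
by symmetric `B₁, B₂` with `det B₁ ≠ 0`, and suppose the cubic `x ↦ det (B₂ − xB₁)` has a UNIQUE real root `μ` which is SIMPLE
(`tr(adj(B₂ − μB₁)·B₁) ≠ 0`, the derivative) — the generic node class R2 (two real nodes and a conjugate pair).  Then ONE congruence brings
every letter to HOLLOW-CORNER form `S_l = Pᵀ [[ε₁u_l + ε₂w_l, α_l, β_l], [α_l, u_l, 0], [β_l, 0, w_l]] P`, `εᵢ ∈ {1,0,−1}` fixed.
Proof: `K = B₂ − μB₁` has rank 2 (simplicity) with a kernel vector `v` — a column of `adj K` — with `a = vᵀB₁v ≠ 0` (since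
`tr K·tr(adj K B₁) = ∑ columns' B₁-squares`); in a frame `(v, p₁, p₂)`, `pᵢ ⊥ B₁v`, the pencil is `(−ya) ⊕ (G − yH)` with
`det G = det V²·tr(adj K B₁)/a ≠ 0`, `det H = det V²·det B₁/a ≠ 0` (coefficient comparison); `det G > 0` would give a second real root
(`exists_ne_zero_detPencil_eq_zero`: definite-anchored binary pencils are real-rooted), so `det G < 0`, `K` is a REAL LINE PAIR on the frame
plane, its isotropic pair (`exists_isotropic_pair`) is the frame of `exists_congr_hollowCorner_of_frame`. [folklore] -/
theorem exists_congr_hollowCorner_of_uniqueRoot (S : Fin 4 → Matrix (Fin 3) (Fin 3) ℝ) (hS : ∀ l, (S l).IsSymm)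
    (B₁ B₂ : Matrix (Fin 3) (Fin 3) ℝ) (hB₁ : B₁.IsSymm) (hB₂ : B₂.IsSymm) (hdet : B₁.det ≠ 0)
    (hann₁ : ∀ l, (B₁ * S l).trace = 0) (hann₂ : ∀ l, (B₂ * S l).trace = 0)
    (μ : ℝ) (hroot : (B₂ - μ • B₁).det = 0) (huniq : ∀ x : ℝ, (B₂ - x • B₁).det = 0 → x = μ)
    (hsimple : ((B₂ - μ • B₁).adjugate * B₁).trace ≠ 0) :
    ∃ (P : Matrix (Fin 3) (Fin 3) ℝ) (ε₁ ε₂ : ℝ) (u w α β : Fin 4 → ℝ), P.det ≠ 0 ∧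
      (ε₁ = 1 ∨ ε₁ = 0 ∨ ε₁ = -1) ∧ (ε₂ = 1 ∨ ε₂ = 0 ∨ ε₂ = -1) ∧
      ∀ l, S l = Pᵀ * !![ε₁ * u l + ε₂ * w l, α l, β l; α l, u l, 0; β l, 0, w l] * P := by
  set K : Matrix (Fin 3) (Fin 3) ℝ := B₂ - μ • B₁ with hKdef
  have hK : K.IsSymm := by
    show Kᵀ = K
    rw [hKdef, transpose_sub, transpose_smul, hB₁.eq, hB₂.eq]
  have hsy : ∀ {B : Matrix (Fin 3) (Fin 3) ℝ}, B.IsSymm → ∀ x y : Fin 3 → ℝ, x ⬝ᵥ (B *ᵥ y) = y ⬝ᵥ (B *ᵥ x) :=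
    fun hB x y => by rw [Matrix.dotProduct_mulVec, ← Matrix.mulVec_transpose, hB.eq, dotProduct_comm]
  have hannK : ∀ l, (K * S l).trace = 0 := by
    intro l
    rw [hKdef, Matrix.sub_mul, Matrix.smul_mul, trace_sub, trace_smul, hann₁, hann₂, smul_zero, sub_zero]
  -- the adjugate `N` of `K`: symmetric, `K N = 0`, `N N = (tr N) N`
  set N : Matrix (Fin 3) (Fin 3) ℝ := K.adjugate with hNdef
  have hNT : Nᵀ = N := by rw [hNdef, Matrix.adjugate_transpose, hK.eq]
  have hKN : K * N = 0 := by rw [hNdef, Matrix.mul_adjugate, hroot, zero_smul]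
  have hNN : N * N = N.trace • N := adjugate_mul_adjugate_of_det_eq_zero hroot
  -- `tr N · tr(N B₁) = ∑ᵢ colᵢᵀ B₁ colᵢ`
  have hNsym : ∀ i j, N i j = N j i := fun i j => by
    have h := congrFun (congrFun hNT i) j
    rw [transpose_apply] at h
    exact h.symm
  have hcolsum : N.trace * (N * B₁).trace = ∑ i, (fun j => N j i) ⬝ᵥ (B₁ *ᵥ fun j => N j i) := by
    have h1 : (N * B₁ * N).trace = N.trace * (N * B₁).trace := by
      rw [Matrix.trace_mul_comm (N * B₁) N, ← Matrix.mul_assoc, hNN, Matrix.smul_mul, Matrix.trace_smul, smul_eq_mul]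
    rw [← h1]
    simp only [Matrix.trace, Matrix.diag, Matrix.mul_apply, dotProduct, Matrix.mulVec, Finset.sum_mul, Finset.mul_sum]
    refine Finset.sum_congr rfl fun i _ => ?_
    rw [Finset.sum_comm]
    refine Finset.sum_congr rfl fun j _ => Finset.sum_congr rfl fun k _ => ?_
    rw [hNsym i j]; ring
  have hNtr : N.trace ≠ 0 := by
    intro h0
    -- `N N = 0` and `N` symmetric force `N = 0`, contradicting simplicity
    have hNN0 : N * N = 0 := by rw [hNN, h0, zero_smul]
    have hN0 : N = 0 := by
      ext i j
      have hdiag : (N * N) i i = 0 := by rw [hNN0]; rfl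
      simp only [Matrix.mul_apply] at hdiag
      have hsq : ∑ k, N i k * N i k = 0 := by
        rw [← hdiag]
        refine Finset.sum_congr rfl fun k _ => ?_
        rw [hNsym k i]
      have hall := (Finset.sum_eq_zero_iff_of_nonneg fun k _ => mul_self_nonneg (N i k)).mp hsq j (Finset.mem_univ j)
      exact mul_self_eq_zero.mp hall
    apply hsimple
    show (N * B₁).trace = 0
    rw [hN0, Matrix.zero_mul, trace_zero]
  -- a column of `N` that is not `B₁`-isotropic
  have hexi : ∃ i, (fun j => N j i) ⬝ᵥ (B₁ *ᵥ fun j => N j i) ≠ 0 := by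
    by_contra h
    push Not at h
    have : N.trace * (N * B₁).trace = 0 := by rw [hcolsum]; exact Finset.sum_eq_zero fun i _ => h i
    rcases mul_eq_zero.mp this with h1 | h1
    · exact hNtr h1
    · exact hsimple h1
  obtain ⟨i₀, hi₀⟩ := hexi
  set v : Fin 3 → ℝ := fun j => N j i₀ with hvdef
  set a := v ⬝ᵥ (B₁ *ᵥ v) with hadef
  have ha : a ≠ 0 := hi₀
  have hKv : K *ᵥ v = 0 := by
    funext j
    have h := congrFun (congrFun hKN j) i₀
    simp only [Matrix.mul_apply, Matrix.zero_apply] at h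
    simp only [Matrix.mulVec, dotProduct, hvdef, Pi.zero_apply]
    exact h
  -- the frame plane: `p₁, p₂ ⊥ n := B₁ v`
  set n : Fin 3 → ℝ := B₁ *ᵥ v with hndef
  have hn : n ≠ 0 := by
    intro h0; apply ha; rw [hadef, h0, dotProduct_zero]
  obtain ⟨p₁, p₂, c, hc, hp₁, hp₂, hdetf⟩ := exists_perp_pair n hn
  have hvp₁ : v ⬝ᵥ (B₁ *ᵥ p₁) = 0 := by rw [hsy hB₁ v p₁, dotProduct_comm]; exact hp₁
  have hvp₂ : v ⬝ᵥ (B₁ *ᵥ p₂) = 0 := by rw [hsy hB₁ v p₂, dotProduct_comm]; exact hp₂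
  set g₁₁ := p₁ ⬝ᵥ (K *ᵥ p₁) with hg₁₁
  set g₁₂ := p₁ ⬝ᵥ (K *ᵥ p₂) with hg₁₂
  set g₂₂ := p₂ ⬝ᵥ (K *ᵥ p₂) with hg₂₂
  set h₁₁ := p₁ ⬝ᵥ (B₁ *ᵥ p₁) with hh₁₁
  set h₁₂ := p₁ ⬝ᵥ (B₁ *ᵥ p₂) with hh₁₂
  set h₂₂ := p₂ ⬝ᵥ (B₁ *ᵥ p₂) with hh₂₂
  set V : Matrix (Fin 3) (Fin 3) ℝ := Matrix.of ![v, p₁, p₂] with hVdef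
  have hVdet : V.det = c * a := by rw [hVdef, hdetf v, hadef, hndef]
  have hVne : V.det ≠ 0 := by rw [hVdet]; exact mul_ne_zero hc ha
  -- the pencil in the frame
  have hblock : ∀ y : ℝ, (V * (K - y • B₁) * Vᵀ).det
      = (-(y * a)) * ((g₁₁ - y * h₁₁) * (g₂₂ - y * h₂₂) - (g₁₂ - y * h₁₂) ^ 2) := by
    intro y
    have hKv' : ∀ x : Fin 3 → ℝ, x ⬝ᵥ (K *ᵥ v) = 0 := fun x => by rw [hKv, dotProduct_zero]
    have hvK' : ∀ x : Fin 3 → ℝ, v ⬝ᵥ (K *ᵥ x) = 0 := fun x => by rw [hsy hK, hKv']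
    have hent : ∀ i j, (V * (K - y • B₁) * Vᵀ) i j
        = (![v, p₁, p₂] i) ⬝ᵥ (K *ᵥ ![v, p₁, p₂] j) - y * ((![v, p₁, p₂] i) ⬝ᵥ (B₁ *ᵥ ![v, p₁, p₂] j)) := by
      intro i j
      rw [hVdef, of_mul_mul_transpose_apply, Matrix.sub_mulVec, Matrix.smul_mulVec, dotProduct_sub, dotProduct_smul,
        smul_eq_mul]
    rw [Matrix.det_fin_three]
    simp only [hent]
    simp [hKv', hvK', hvp₁, hvp₂, hsy hB₁ p₁ v, hsy hB₁ p₂ v, hsy hK p₂ p₁, hsy hB₁ p₂ p₁, ← hg₁₁, ← hg₁₂, ← hg₂₂, ← hh₁₁,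
      ← hh₁₂, ← hh₂₂]
    ring
  have hdetV : ∀ y : ℝ, (V * (K - y • B₁) * Vᵀ).det = V.det ^ 2 * (K - y • B₁).det := fun y => by
    rw [det_mul, det_mul, det_transpose]; ring
  have hcubic : ∀ y : ℝ, (K - y • B₁).det
      = -y * (N * B₁).trace + y ^ 2 * (B₁.adjugate * K).trace + -(y ^ 3) * B₁.det := by
    intro y
    rw [show K - y • B₁ = K + (-y) • B₁ by rw [neg_smul, sub_eq_add_neg], det_add_smul_fin_three, hroot, zero_add, hNdef]
    ring
  have hshift : ∀ y : ℝ, (K - y • B₁).det = (B₂ - (μ + y) • B₁).det := fun y => by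
    rw [hKdef, add_smul, sub_sub]
  -- coefficient comparison: `det G` and `det H` are non-zero
  have hcoef := cubic_coeff_unique (-(V.det ^ 2 * (N * B₁).trace)) (V.det ^ 2 * (B₁.adjugate * K).trace) (-(V.det ^ 2 * B₁.det))
    (-(a * (g₁₁ * g₂₂ - g₁₂ ^ 2))) (a * (g₂₂ * h₁₁ - 2 * g₁₂ * h₁₂ + g₁₁ * h₂₂)) (-(a * (h₁₁ * h₂₂ - h₁₂ ^ 2))) (fun y => by
      have h1 := hblock y
      rw [hdetV y, hcubic y] at h1
      linear_combination h1)
  obtain ⟨hc1, -, hc3⟩ := hcoef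
  have hg0 : g₁₁ * g₂₂ - g₁₂ ^ 2 ≠ 0 := by
    intro h0; rw [h0, mul_zero, neg_zero, neg_eq_zero] at hc1
    exact (mul_ne_zero (pow_ne_zero 2 hVne) hsimple) hc1
  have hh0 : h₁₁ * h₂₂ - h₁₂ ^ 2 ≠ 0 := by
    intro h0; rw [h0, mul_zero, neg_zero, neg_eq_zero] at hc3
    exact (mul_ne_zero (pow_ne_zero 2 hVne) hdet) hc3
  -- `det G < 0`: otherwise a second real root
  have hgneg : g₁₁ * g₂₂ - g₁₂ ^ 2 < 0 := by
    rcases lt_or_gt_of_ne hg0 with h | h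
    · exact h
    · exfalso
      obtain ⟨y₀, hy₀, hquad⟩ := exists_ne_zero_detPencil_eq_zero g₁₁ g₁₂ g₂₂ h₁₁ h₁₂ h₂₂ h hh0
      have h1 : (K - y₀ • B₁).det = 0 := by
        have h2 := hblock y₀
        rw [hquad, mul_zero, hdetV] at h2
        rcases mul_eq_zero.mp h2 with h3 | h3
        · exact absurd h3 (pow_ne_zero 2 hVne)
        · exact h3
      rw [hshift] at h1
      have := huniq _ h1
      exact hy₀ (by linarith)
  -- the isotropic frame
  obtain ⟨s₁, t₁, s₂, t₂, hq₁, hq₂, hcross, hind⟩ := exists_isotropic_pair g₁₁ g₁₂ g₂₂ hgneg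
  set w₁ : Fin 3 → ℝ := s₁ • p₁ + t₁ • p₂ with hw₁def
  set w₂ : Fin 3 → ℝ := s₂ • p₁ + t₂ • p₂ with hw₂def
  have hw₁ : v ⬝ᵥ (B₁ *ᵥ w₁) = 0 := by
    rw [hw₁def, Matrix.mulVec_add, Matrix.mulVec_smul, Matrix.mulVec_smul, dotProduct_add, dotProduct_smul, dotProduct_smul,
      hvp₁, hvp₂, smul_zero, smul_zero, add_zero]
  have hw₂ : v ⬝ᵥ (B₁ *ᵥ w₂) = 0 := by
    rw [hw₂def, Matrix.mulVec_add, Matrix.mulVec_smul, Matrix.mulVec_smul, dotProduct_add, dotProduct_smul, dotProduct_smul,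
      hvp₁, hvp₂, smul_zero, smul_zero, add_zero]
  have hiso₁ : w₁ ⬝ᵥ (K *ᵥ w₁) = 0 := by
    rw [hw₁def, dotProduct_mulVec_combo hK, ← hg₁₁, ← hg₁₂, ← hg₂₂, ← hq₁]; ring
  have hiso₂ : w₂ ⬝ᵥ (K *ᵥ w₂) = 0 := by
    rw [hw₂def, dotProduct_mulVec_combo hK, ← hg₁₁, ← hg₁₂, ← hg₂₂, ← hq₂]; ring
  have hκ : w₁ ⬝ᵥ (K *ᵥ w₂) ≠ 0 := by
    rw [hw₁def, hw₂def, dotProduct_mulVec_combo hK, ← hg₁₁, ← hg₁₂, ← hg₂₂]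
    convert hcross using 1; ring
  have hVw : (Matrix.of ![v, w₁, w₂]).det ≠ 0 := by
    rw [hw₁def, hw₂def, det_of_combo_rows, ← hVdef]
    exact mul_ne_zero hind hVne
  exact exists_congr_hollowCorner_of_frame S hS B₁ K hB₁ hK hann₁ hannK v w₁ w₂ hVw hKv ha hw₁ hw₂ hiso₁ hiso₂ hκ

/-! ## 10. Census form on the R2 sector -/

/-- **THE R2 CHART THEOREM, census form** (all supports): on any exponent vector `d`, a real symmetric `(3,4)` pencil whose annihilator
pencil has `det B₁ ≠ 0` and a unique, simple real root has EXACTLY as many distinct positive det-roots as some hollow-corner pencil on `d`.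
[folklore] -/
theorem card_posRoots_eq_hollowCorner_of_uniqueRoot (d : Fin 4 → ℕ) (S : Fin 4 → Matrix (Fin 3) (Fin 3) ℝ)
    (hS : ∀ l, (S l).IsSymm) (B₁ B₂ : Matrix (Fin 3) (Fin 3) ℝ) (hB₁ : B₁.IsSymm) (hB₂ : B₂.IsSymm) (hdet : B₁.det ≠ 0)
    (hann₁ : ∀ l, (B₁ * S l).trace = 0) (hann₂ : ∀ l, (B₂ * S l).trace = 0)
    (μ : ℝ) (hroot : (B₂ - μ • B₁).det = 0) (huniq : ∀ x : ℝ, (B₂ - x • B₁).det = 0 → x = μ)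
    (hsimple : ((B₂ - μ • B₁).adjugate * B₁).trace ≠ 0) :
    ∃ (ε₁ ε₂ : ℝ) (u w α β : Fin 4 → ℝ), (ε₁ = 1 ∨ ε₁ = 0 ∨ ε₁ = -1) ∧ (ε₂ = 1 ∨ ε₂ = 0 ∨ ε₂ = -1) ∧
      ((Matrix.det (∑ l, ((Polynomial.X : Polynomial ℝ) ^ d l) • (S l).map Polynomial.C)).roots.toFinset.filter
          (fun t => 0 < t)).card
        = ((Matrix.det (∑ l, ((Polynomial.X : Polynomial ℝ) ^ d l) •
            (!![ε₁ * u l + ε₂ * w l, α l, β l; α l, u l, 0; β l, 0, w l] : Matrix (Fin 3) (Fin 3) ℝ).map Polynomial.C)).roots.toFinset.filter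
              (fun t => 0 < t)).card := by
  obtain ⟨P, ε₁, ε₂, u, w, α, β, hP, hε₁, hε₂, hSP⟩ :=
    exists_congr_hollowCorner_of_uniqueRoot S hS B₁ B₂ hB₁ hB₂ hdet hann₁ hann₂ μ hroot huniq hsimple
  refine ⟨ε₁, ε₂, u, w, α, β, hε₁, hε₂, ?_⟩
  have hfun : S = fun l => Pᵀ * !![ε₁ * u l + ε₂ * w l, α l, β l; α l, u l, 0; β l, 0, w l] * P := funext hSP
  rw [hfun, card_posRoots_congr d _ Pᵀ P (by rwa [det_transpose]) hP]

/-- **THE DOOR ON THE R2 SECTOR REDUCES TO SIXTEEN-PARAMETER HOLLOW-CORNER ROWS.** [folklore] -/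
theorem card_posRoots_le_of_hollowCorner_rows_uniqueRoot (d : Fin 4 → ℕ) {B : ℕ}
    (hrows : ∀ (ε₁ ε₂ : ℝ) (u w α β : Fin 4 → ℝ), (ε₁ = 1 ∨ ε₁ = 0 ∨ ε₁ = -1) → (ε₂ = 1 ∨ ε₂ = 0 ∨ ε₂ = -1) →
      ((Matrix.det (∑ l, ((Polynomial.X : Polynomial ℝ) ^ d l) •
          (!![ε₁ * u l + ε₂ * w l, α l, β l; α l, u l, 0; β l, 0, w l] : Matrix (Fin 3) (Fin 3) ℝ).map Polynomial.C)).roots.toFinset.filter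
            (fun t => 0 < t)).card ≤ B)
    (S : Fin 4 → Matrix (Fin 3) (Fin 3) ℝ) (hS : ∀ l, (S l).IsSymm)
    (B₁ B₂ : Matrix (Fin 3) (Fin 3) ℝ) (hB₁ : B₁.IsSymm) (hB₂ : B₂.IsSymm) (hdet : B₁.det ≠ 0)
    (hann₁ : ∀ l, (B₁ * S l).trace = 0) (hann₂ : ∀ l, (B₂ * S l).trace = 0)
    (μ : ℝ) (hroot : (B₂ - μ • B₁).det = 0) (huniq : ∀ x : ℝ, (B₂ - x • B₁).det = 0 → x = μ)
    (hsimple : ((B₂ - μ • B₁).adjugate * B₁).trace ≠ 0) :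
    ((Matrix.det (∑ l, ((Polynomial.X : Polynomial ℝ) ^ d l) • (S l).map Polynomial.C)).roots.toFinset.filter
        (fun t => 0 < t)).card ≤ B := by
  obtain ⟨ε₁, ε₂, u, w, α, β, hε₁, hε₂, hcard⟩ :=
    card_posRoots_eq_hollowCorner_of_uniqueRoot d S hS B₁ B₂ hB₁ hB₂ hdet hann₁ hann₂ μ hroot huniq hsimple
  rw [hcard]
  exact hrows ε₁ ε₂ u w α β hε₁ hε₂

end Summit.ValiantsHypothesis.ValiantsHypothesis.Theorems.LacunarySymmetroidMatrixDescartes.Census.EqualDiagonal
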